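import Mathlib.MeasureTheory.Group.Integral
import Mathlib.MeasureTheory.Measure.Haar.NormedSpace
import Mathlib.Analysis.Distribution.SchwartzSpace.Basic
import Literature.NumberTheory.LFunctions.RudnickSarnakZeros
import Literature.NumberTheory.LFunctions.RudnickSarnakLocal
import Literature.NumberTheory.LFunctions.PairCorrelationSmallGaps
import HarnessLib

/-!
# `2`-level statistics of zeta zeros: pair sums, slices, symmetrised bumps (proved)

Trunk T-ANT (`Literature/NumberTheory/LFunctions`). Proofs only: no definitions, no named facts.
Bookkeeping for the discharge of the named fact `gueHypothesisAt_one_iff_montgomery`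
(`ZeroStatistics.lean`: `GUEHypothesisAt 1 ↔ MontgomeryPairCorrelation`; Rudnick–Sarnak 1996,
§1 Remark 1; Montgomery 1973, (12)):

* the GUE pair density `w(u) = 1 − K(u)²` (`K = sineKernel`): `0 ≤ w ≤ 1`, evenness, and
  `W₂(0, y) = w(y)` (`sineDeterminant_fin_two`); continuity is
  `PairCorrelationSmallGaps.continuous_sineGap`;
* `levelCorrelationSum 2 f N` as a sum over the off-diagonal pairs of indices `< N`
  (`GUEMontgomery.levelCorrelationSum_two`) and the swap symmetry of such sums;
* Montgomery's count `pairCorrelationCount α β T` = off-diagonal pairs with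
  `(γ_a − γ_b) log T / 2π ∈ [α, β]` plus the diagonal `N(T) · [0 ∈ [α, β]]`
  (`GUEMontgomery.pairCorrelationCount_eq`);
* slices of Rudnick–Sarnak test functions of two variables: `f(x, y) = g(y − x)` with
  `g(u) = f(0, u)` a Schwartz function on `ℝ`, its decay, and
  `rsLimit 1 f = ∫ g(u) w(u) du`;
* the symmetrised bump test functions `f_h(x, y) = h(x − y) + h(y − x)` (`h` smooth, compactly
  supported) and the consequence of `GUEHypothesisAt 1`:
  `(1/N) ∑_{a ≠ b < N} h(γ̃_a − γ̃_b) → ∫ h w` (`GUEMontgomery.tendsto_sum_bump_div`).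

## References

* Z. Rudnick, P. Sarnak, *Zeros of principal `L`-functions and random matrix theory*, Duke Math.
  J. 81 (1996), 269–322, §1 (TF1–TF3, (1.3), (1.5), Remark 1).
* H. L. Montgomery, Proc. Sympos. Pure Math. 24 (1973), 181–193, (12), (15).
-/

noncomputable section

open Finset Filter Topology MeasureTheory Complex
open scoped Real ContDiff

namespace Literature.NumberTheory.LFunctions

namespace GUEMontgomery

/-! ## The pair density `w = 1 − K²` -/

/-- `0 ≤ 1 − K(u)²` (`|sinc| ≤ 1`). [folklore] -/
theorem pairDensity_nonneg (u : ℝ) : 0 ≤ 1 - sineKernel u ^ 2 := by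
  have h := Real.abs_sinc_le_one (π * u)
  have : sineKernel u ^ 2 ≤ 1 := by
    rw [sineKernel, ← sq_abs]
    nlinarith [abs_nonneg (Real.sinc (π * u))]
  linarith

/-- `1 − K(u)² ≤ 1`. [folklore] -/
theorem pairDensity_le_one (u : ℝ) : 1 - sineKernel u ^ 2 ≤ 1 := by
  nlinarith [sq_nonneg (sineKernel u)]

/-- `K(−u) = K(u)`. [folklore] -/
theorem sineKernel_neg (u : ℝ) : sineKernel (-u) = sineKernel u := by
  simp only [sineKernel, mul_neg, Real.sinc_neg]

/-- `1 − K(−u)² = 1 − K(u)²`. [folklore] -/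
theorem pairDensity_neg (u : ℝ) : 1 - sineKernel (-u) ^ 2 = 1 - sineKernel u ^ 2 := by
  rw [sineKernel_neg]

/-- `Fin.cons 0 y = ![0, y 0]` on `ℝ¹`. [folklore] -/
theorem cons_zero_eq_vec (y : Fin 1 → ℝ) : (Fin.cons 0 y : Fin 2 → ℝ) = ![0, y 0] := by
  ext i
  fin_cases i <;> rfl

/-- `W₂(0, y) = 1 − K(y)²` for `y ∈ ℝ¹` (Montgomery's pair density as the `2`-level GUE
density; `sineDeterminant_fin_two`). [cite: Montgomery1973, §1 (15)] -/
theorem sineDeterminant_cons_zero (y : Fin 1 → ℝ) :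
    sineDeterminant (Fin.cons 0 y : Fin 2 → ℝ) = 1 - sineKernel (y 0) ^ 2 := by
  rw [cons_zero_eq_vec, sineDeterminant_fin_two]
  simp [sineKernel_neg]

/-! ## Pair sums -/

/-- `levelCorrelationSum 2 f N = ∑_{a ≠ b < N} f(γ̃_a, γ̃_b)`, the sum over the off-diagonal
pairs of indices (Rudnick–Sarnak (1.3) with `n = 2`). [cite: RudnickSarnak1996, (1.3)] -/
theorem levelCorrelationSum_two (f : (Fin 2 → ℝ) → ℂ) (N : ℕ) :
    levelCorrelationSum 2 f N =
      ∑ p ∈ (Finset.range N).offDiag, f ![normalizedOrdinate p.1, normalizedOrdinate p.2] := by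
  classical
  rw [RudnickSarnak.levelCorrelationSum_eq_sum_filter]
  refine Finset.sum_nbij' (fun u ↦ (u 0, u 1)) (fun p ↦ ![p.1, p.2]) ?_ ?_ ?_ ?_ ?_
  · intro u hu
    rw [Finset.mem_filter, Fintype.mem_piFinset] at hu
    rw [Finset.mem_offDiag]
    exact ⟨hu.1 0, hu.1 1, fun h ↦ absurd (hu.2 h) (by decide)⟩
  · intro p hp
    rw [Finset.mem_offDiag] at hp
    rw [Finset.mem_filter, Fintype.mem_piFinset]
    refine ⟨fun a ↦ ?_, ?_⟩
    · fin_cases a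
      · simpa using hp.1
      · simpa using hp.2.1
    · intro a b hab
      fin_cases a <;> fin_cases b
      · rfl
      · exact absurd hab (by simpa using hp.2.2)
      · exact absurd hab.symm (by simpa using hp.2.2)
      · rfl
  · intro u _
    funext a
    fin_cases a <;> rfl
  · intro p _
    simp
  · intro u _
    congr 1
    funext a
    fin_cases a <;> rfl

/-- Swap symmetry of sums over off-diagonal pairs. [folklore] -/
theorem sum_offDiag_swap {M : Type*} [AddCommMonoid M] (s : Finset ℕ) (F : ℕ → ℕ → M) :
    ∑ p ∈ s.offDiag, F p.2 p.1 = ∑ p ∈ s.offDiag, F p.1 p.2 := by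
  refine Finset.sum_nbij' Prod.swap Prod.swap ?_ ?_ (fun p _ ↦ by simp) (fun p _ ↦ by simp)
    (fun p _ ↦ rfl)
  · intro p hp
    rw [Finset.mem_offDiag] at hp ⊢
    exact ⟨hp.2.1, hp.1, hp.2.2.symm⟩
  · intro p hp
    rw [Finset.mem_offDiag] at hp ⊢
    exact ⟨hp.2.1, hp.1, hp.2.2.symm⟩

/-! ## Montgomery's count: diagonal plus off-diagonal pairs -/

/-- For `log T > 0`, Montgomery's count `pairCorrelationCount α β T` (ordered pairs of indices
`< N(T)`, diagonal included, with `2πα/log T ≤ γ_a − γ_b ≤ 2πβ/log T`) equals the number of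
off-diagonal pairs with `(γ_a − γ_b) log T / 2π ∈ [α, β]` plus the diagonal contribution
`N(T) · [0 ∈ [α, β]]` (Montgomery's `δ(α, β)`; Montgomery 1973, the remark after (12)). [cite: Montgomery1973, §1 Conjecture (12)] -/
theorem pairCorrelationCount_eq {α β T : ℝ} (hT : 0 < Real.log T) :
    (pairCorrelationCount α β T : ℝ) =
      ((((Finset.range (zetaZeroCount T)).offDiag).filter fun p : ℕ × ℕ ↦
        (zetaOrdinate p.1 - zetaOrdinate p.2) * Real.log T / (2 * π) ∈ Set.Icc α β).card : ℝ) +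
        if (0 : ℝ) ∈ Set.Icc α β then (zetaZeroCount T : ℝ) else 0 := by
  classical
  set s := Finset.range (zetaZeroCount T) with hs
  have h2pi : (0 : ℝ) < 2 * π := by positivity
  -- the window condition in the two forms
  have hwin : ∀ p : ℕ × ℕ,
      (2 * π * α / Real.log T ≤ zetaOrdinate p.1 - zetaOrdinate p.2 ∧
        zetaOrdinate p.1 - zetaOrdinate p.2 ≤ 2 * π * β / Real.log T) ↔
      (zetaOrdinate p.1 - zetaOrdinate p.2) * Real.log T / (2 * π) ∈ Set.Icc α β := by
    intro p
    rw [Set.mem_Icc, div_le_iff₀ hT, le_div_iff₀ hT, le_div_iff₀ h2pi, div_le_iff₀ h2pi]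
    constructor <;> rintro ⟨h1, h2⟩ <;> constructor <;> nlinarith
  have hpcc : pairCorrelationCount α β T =
      ((s ×ˢ s).filter fun p : ℕ × ℕ ↦
        (zetaOrdinate p.1 - zetaOrdinate p.2) * Real.log T / (2 * π) ∈ Set.Icc α β).card := by
    unfold pairCorrelationCount zeroIndexSet
    rw [← hs]
    congr 1
    exact Finset.filter_congr fun p _ ↦ hwin p
  rw [hpcc, ← Finset.diag_union_offDiag, Finset.filter_union,
    Finset.card_union_of_disjoint (Finset.disjoint_filter_filter (Finset.disjoint_diag_offDiag s)),
    Nat.cast_add, add_comm]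
  congr 1
  -- the diagonal
  by_cases h0 : (0 : ℝ) ∈ Set.Icc α β
  · rw [if_pos h0]
    have : (s.diag.filter fun p : ℕ × ℕ ↦
        (zetaOrdinate p.1 - zetaOrdinate p.2) * Real.log T / (2 * π) ∈ Set.Icc α β) = s.diag := by
      refine Finset.filter_true_of_mem fun p hp ↦ ?_
      rw [Finset.mem_diag] at hp
      rw [hp.2, sub_self, zero_mul, zero_div]
      exact h0
    rw [this, Finset.diag_card, hs, Finset.card_range]
  · rw [if_neg h0]
    have : (s.diag.filter fun p : ℕ × ℕ ↦
        (zetaOrdinate p.1 - zetaOrdinate p.2) * Real.log T / (2 * π) ∈ Set.Icc α β) = ∅ := by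
      refine Finset.filter_false_of_mem fun p hp ↦ ?_
      rw [Finset.mem_diag] at hp
      rw [hp.2, sub_self, zero_mul, zero_div]
      exact h0
    rw [this, Finset.card_empty, Nat.cast_zero]

/-! ## Slices of Rudnick–Sarnak test functions of two variables -/

/-- A diagonal-invariant `f` (TF2) satisfies `f(x, y) = f(0, y − x)`. [cite: RudnickSarnak1996, §1 TF1–TF3] -/
theorem apply_vec_eq_apply_zero_sub {f : (Fin 2 → ℝ) → ℂ}
    (hdiag : ∀ (x : Fin 2 → ℝ) (t : ℝ), f (fun i ↦ x i + t) = f x) (x y : ℝ) :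
    f ![x, y] = f ![0, y - x] := by
  rw [← hdiag ![x, y] (-x)]
  congr 1
  funext i
  fin_cases i
  · simp
  · simp [sub_eq_add_neg]

/-- The slice `u ↦ f(0, u)` of a Rudnick–Sarnak test function of two variables is a Schwartz
function on `ℝ` (TF3, transported along `ℝ ≃ ℝ¹`). [cite: RudnickSarnak1996, §1 TF1–TF3] -/
theorem exists_schwartz_slice {f : (Fin 2 → ℝ) → ℂ} (hf : IsRSTestFunction 1 f) :
    ∃ g : SchwartzMap ℝ ℂ, ∀ u : ℝ, g u = f ![0, u] := by
  obtain ⟨g₁, hg₁⟩ := hf.schwartz_slice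
  refine ⟨SchwartzMap.compCLMOfContinuousLinearEquiv ℝ
      (ContinuousLinearEquiv.funUnique (Fin 1) ℝ ℝ).symm g₁, fun u ↦ ?_⟩
  rw [SchwartzMap.compCLMOfContinuousLinearEquiv_apply, Function.comp_apply]
  have h1 := congrFun hg₁ ((ContinuousLinearEquiv.funUnique (Fin 1) ℝ ℝ).symm u)
  rw [h1, rsSlice, cons_zero_eq_vec]
  rfl

/-- Decay of the slice: `‖f(0, u)‖ ≤ C (1 + |u|)⁻²` (the pivot bound
`IsRSTestFunction.exists_norm_le_prod` with pivot `0`). [cite: RudnickSarnak1996, §1 TF1–TF3] -/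
theorem exists_norm_slice_le {f : (Fin 2 → ℝ) → ℂ} (hf : IsRSTestFunction 1 f) :
    ∃ C : ℝ, 0 ≤ C ∧ ∀ u : ℝ, ‖f ![0, u]‖ ≤ C * ((1 + |u|) ^ 2)⁻¹ := by
  obtain ⟨C, hC0, hC⟩ := hf.exists_norm_le_prod
  refine ⟨C, hC0, fun u ↦ ?_⟩
  have h := hC ![0, u] 0
  rw [Fin.prod_univ_two] at h
  simpa using h

/-- `rsLimit 1 f = ∫ f(0, u) (1 − K(u)²) du` (the right-hand side of Rudnick–Sarnak's
Theorem 1.2 for `n = 2`, along `ℝ¹ ≃ ℝ`, with `W₂(0, u) = 1 − K(u)²`). [cite: RudnickSarnak1996, Thm 1.2] -/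
theorem rsLimit_one_eq (f : (Fin 2 → ℝ) → ℂ) :
    rsLimit 1 f = ∫ u : ℝ, f ![0, u] * ((1 - sineKernel u ^ 2 : ℝ) : ℂ) := by
  unfold rsLimit
  have h1 : ∀ y : Fin 1 → ℝ, rsSlice f y * (sineDeterminant (Fin.cons 0 y : Fin 2 → ℝ) : ℂ) =
      (fun u : ℝ ↦ f ![0, u] * ((1 - sineKernel u ^ 2 : ℝ) : ℂ)) (y 0) := by
    intro y
    simp only [rsSlice]
    rw [sineDeterminant_cons_zero, cons_zero_eq_vec]
  simp_rw [h1]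
  exact (volume_preserving_funUnique (Fin 1) ℝ).integral_comp'
    (fun u : ℝ ↦ f ![0, u] * ((1 - sineKernel u ^ 2 : ℝ) : ℂ))

/-! ## Symmetrised bump test functions -/

/-- For `h` smooth with compact support, `f_h(x, y) = h(x − y) + h(y − x)` is a Rudnick–Sarnak
test function of two variables (TF1 symmetric, TF2 diagonal-invariant, TF3 its slice
`u ↦ h(−u) + h(u)` is smooth with compact support, hence Schwartz). [cite: RudnickSarnak1996, §1 TF1–TF3] -/
theorem isRSTestFunction_symmBump {h : ℝ → ℝ} (hh : ContDiff ℝ ∞ h)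
    (hhs : HasCompactSupport h) :
    IsRSTestFunction 1 (fun x : Fin 2 → ℝ ↦ ((h (x 0 - x 1) + h (x 1 - x 0) : ℝ) : ℂ)) where
  diag_invariant x t := by
    simp only
    ring_nf
  symmetric σ x := by
    simp only [Function.comp_apply]
    have key : ∀ τ : Equiv.Perm (Fin 2), (τ 0 = 0 ∧ τ 1 = 1) ∨ (τ 0 = 1 ∧ τ 1 = 0) := by
      decide
    rcases key σ with ⟨h0, h1⟩ | ⟨h0, h1⟩
    · rw [h0, h1]
    · rw [h0, h1, add_comm]
  schwartz_slice := by
    obtain ⟨F, hF⟩ : ∃ F : (Fin 1 → ℝ) → ℂ, F = fun y ↦ ((h (-(y 0)) + h (y 0) : ℝ) : ℂ) :=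
      ⟨_, rfl⟩
    have hFs : ContDiff ℝ ∞ F := by
      have h0 : ContDiff ℝ ∞ (fun y : Fin 1 → ℝ ↦ y 0) := contDiff_apply ℝ ℝ 0
      rw [hF]
      exact ofRealCLM.contDiff.comp ((hh.comp h0.neg).add (hh.comp h0))
    have hFc : HasCompactSupport F := by
      obtain ⟨r, hr⟩ := hhs.isCompact.isBounded.subset_closedBall 0
      have hzero : ∀ x : ℝ, r < |x| → h x = 0 := by
        intro x hx
        by_contra hne
        have := hr (subset_tsupport _ hne)
        rw [Metric.mem_closedBall, dist_zero_right, Real.norm_eq_abs] at this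
        linarith
      refine HasCompactSupport.intro (isCompact_closedBall (0 : Fin 1 → ℝ) r) fun y hy ↦ ?_
      rw [Metric.mem_closedBall, dist_zero_right, pi_norm_le_iff_of_nonempty] at hy
      push Not at hy
      obtain ⟨i, hi⟩ := hy
      have hi0 : r < |y 0| := by simpa [Subsingleton.elim i 0] using hi
      have h1 : h (y 0) = 0 := hzero _ hi0
      have h2 : h (-(y 0)) = 0 := hzero _ (by rwa [abs_neg])
      simp [hF, h1, h2]
    refine ⟨hFc.toSchwartzMap hFs, ?_⟩
    funext y
    show F y = rsSlice _ y
    simp [hF, rsSlice]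

/-- `levelCorrelationSum 2 f_h N = 2 ∑_{a ≠ b < N} h(γ̃_a − γ̃_b)` (swap symmetry). [cite: RudnickSarnak1996, (1.3)] -/
theorem levelCorrelationSum_symmBump (h : ℝ → ℝ) (N : ℕ) :
    levelCorrelationSum 2 (fun x : Fin 2 → ℝ ↦ ((h (x 0 - x 1) + h (x 1 - x 0) : ℝ) : ℂ)) N =
      ((2 * ∑ p ∈ (Finset.range N).offDiag,
        h (normalizedOrdinate p.1 - normalizedOrdinate p.2) : ℝ) : ℂ) := by
  rw [levelCorrelationSum_two]
  simp only [Matrix.cons_val_zero, Matrix.cons_val_one]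
  push_cast
  rw [Finset.sum_add_distrib, two_mul]
  congr 1
  exact sum_offDiag_swap (Finset.range N)
    (fun a b ↦ ((h (normalizedOrdinate a - normalizedOrdinate b) : ℝ) : ℂ))

/-- `rsLimit 1 f_h = 2 ∫ h(u) (1 − K(u)²) du` (`K²` is even). [cite: RudnickSarnak1996, Thm 1.2] -/
theorem rsLimit_symmBump {h : ℝ → ℝ} (hh : Continuous h) (hhs : HasCompactSupport h) :
    rsLimit 1 (fun x : Fin 2 → ℝ ↦ ((h (x 0 - x 1) + h (x 1 - x 0) : ℝ) : ℂ)) =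
      ((2 * ∫ u : ℝ, h u * (1 - sineKernel u ^ 2) : ℝ) : ℂ) := by
  rw [rsLimit_one_eq]
  simp only [Matrix.cons_val_zero, Matrix.cons_val_one, zero_sub, sub_zero]
  have hpt : ∀ u : ℝ, ((h (-u) + h u : ℝ) : ℂ) * ((1 - sineKernel u ^ 2 : ℝ) : ℂ) =
      ((h (-u) * (1 - sineKernel u ^ 2) + h u * (1 - sineKernel u ^ 2) : ℝ) : ℂ) := by
    intro u
    push_cast
    ring
  simp_rw [hpt, integral_complex_ofReal]
  congr 1
  have hw := PairCorrelationSmallGaps.continuous_sineGap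
  have hint1 : Integrable fun u : ℝ ↦ h u * (1 - sineKernel u ^ 2) :=
    (hh.mul hw).integrable_of_hasCompactSupport hhs.mul_right
  have hint2 : Integrable fun u : ℝ ↦ h (-u) * (1 - sineKernel u ^ 2) :=
    ((hh.comp continuous_neg).mul hw).integrable_of_hasCompactSupport
      ((hhs.comp_homeomorph (Homeomorph.neg ℝ)).mul_right)
  rw [integral_add hint2 hint1, two_mul]
  congr 1
  have := integral_neg_eq_self (fun u : ℝ ↦ h u * (1 - sineKernel u ^ 2)) volume
  simp_rw [pairDensity_neg] at this
  exact this

/-- **GUE(2-level) on bumps.** Under `GUEHypothesisAt 1`, for every smooth compactly supported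
`h : ℝ → ℝ`: `(1/N) ∑_{a ≠ b < N} h(γ̃_a − γ̃_b) → ∫ h(u) (1 − K(u)²) du`
(apply the hypothesis to `f_h` and take real parts). [cite: RudnickSarnak1996, §1 Remark 1] -/
theorem tendsto_sum_bump_div (hG : GUEHypothesisAt 1) {h : ℝ → ℝ} (hh : ContDiff ℝ ∞ h)
    (hhs : HasCompactSupport h) :
    Tendsto (fun N : ℕ ↦ (∑ p ∈ (Finset.range N).offDiag,
      h (normalizedOrdinate p.1 - normalizedOrdinate p.2)) / (N : ℝ)) atTop
      (𝓝 (∫ u : ℝ, h u * (1 - sineKernel u ^ 2))) := by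
  obtain ⟨L, hL⟩ : ∃ L : ℝ, L = ∫ u : ℝ, h u * (1 - sineKernel u ^ 2) := ⟨_, rfl⟩
  obtain ⟨S, hS⟩ : ∃ S : ℕ → ℝ, S = fun N ↦ ∑ p ∈ (Finset.range N).offDiag,
    h (normalizedOrdinate p.1 - normalizedOrdinate p.2) := ⟨_, rfl⟩
  have hlim : Tendsto (fun N : ℕ ↦ levelCorrelationSum 2
      (fun x : Fin 2 → ℝ ↦ ((h (x 0 - x 1) + h (x 1 - x 0) : ℝ) : ℂ)) N / (N : ℂ)) atTop
      (𝓝 (rsLimit 1 (fun x : Fin 2 → ℝ ↦ ((h (x 0 - x 1) + h (x 1 - x 0) : ℝ) : ℂ)))) :=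
    hG _ (isRSTestFunction_symmBump hh hhs)
  rw [rsLimit_symmBump hh.continuous hhs, ← hL] at hlim
  simp_rw [levelCorrelationSum_symmBump] at hlim
  -- real parts
  have hre := (Complex.continuous_re.tendsto _).comp hlim
  have hre' : Tendsto (fun N : ℕ ↦ 2 * S N / N) atTop (𝓝 (2 * L)) := by
    refine (hre.congr fun N ↦ ?_).trans ?_
    · simp only [Function.comp_apply, Complex.div_natCast_re, Complex.ofReal_re, hS]
    · simp only [Complex.ofReal_re]
      rfl
  have h2 := hre'.const_mul (1 / 2 : ℝ)
  rw [show (1 / 2 : ℝ) * (2 * L) = L by ring, hL] at h2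
  refine h2.congr fun N ↦ ?_
  rw [hS]
  ring

end GUEMontgomery

end Literature.NumberTheory.LFunctions

end
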